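import Literature.MathematicalPhysics.QuantumFieldTheory.Balaban1983to89.B7Ineq148
import Literature.MathematicalPhysics.QuantumFieldTheory.Balaban1983to89.B7TransferAnalyticMean
import HarnessLib

/-!
# Route `UnitScaleTilt`, crux K1 «MinimiserStabilityRegPr» (stmt-QuantumFields-19200), stub V2′ `stub_halvingStep`, C_E node after RULING g26-№6 — (S4′) THE ONE-STEP
# LETTER (148) OF THE (149)–(155) TOWER FROM A SUP LETTER ALONE: for a holomorphic map of finitely many variables, bounded by `B` on the sup-ball of radius `R` and
# vanishing at `0`, the derivative of its second-order remainder `C − DC(0)` at a point of sup-size `s < R/8` has the ℓ¹-kernel bound `(32B/R²)·s·Σ_b‖δA_b‖`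
# — [Balaban1985Averaging] (148) «following easily from general properties of the function C(V₀, A)», here with NO separate quadratic input ((123) is derived);
# + the read-set localisation that turns a one-step map of ALL level variables into a function of its finitely many read variables

Cell `ym3-torus` (HUMAN RULING D-0037: YM₃ on the torus is ladder rung R3, not the Clay problem), width seat `ym-ust-19936-w5` gen 3; `--supports stmt-QuantumFields-19200
--as helper`; def-free, 0 sorry; generic (any finite index type, complex normed spaces).  ★★OWNER ACK 20 (a): «(S4′) GO».

WHY.  Hypothesis `hE` of ✓`ChartKernelTower.kernel_tower_bound` (p610533) is print's (148) for the one-step DOUBLE-BAR chart in log coordinates, `W ↦ −i·log(U̿(e^{iW}))(c)`,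
at the orbit point `V_m(0)` of sup-size `s_m` on the two-block read set of `c`: `‖D(Φ − T)(V)[w]‖ ≤ G·s_m·Σ_{read}‖w‖`.  lit-balaban's ✓`B7Ineq148.norm_fderiv_apply_le_sum` gives it
from holomorphy + a QUADRATIC bound `‖C(A)‖ ≤ K‖A‖²`; for the ♭ one step the tree will carry (B1∕B2 of RULING g26-№7) holomorphy + a SUP bound + the flat derivative `DΦ(0) = L·Q`
(CERT-2's one-step engine), and the quadratic bound is then itself a Cauchy estimate (✓`B7TransferAnalyticMean.norm_sub_sub_fderiv_le_of_line`, the route of ✓`Prop8Chart.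
norm_chartLog_sub_fderiv_le_weightedBall`).  This file composes the two once, abstractly, and adds the localisation glue (the one-step map reads only the two blocks of `c`).
WHAT.
* §1 `norm_sub_fderiv_zero_le_of_sup` — `C` ℂ-differentiable on `ball 0 R`, `‖C‖ ≤ B` there, `C 0 = 0`, `4‖Z‖ ≤ R` ⇒ `‖C Z − DC(0)Z‖ ≤ 8B‖Z‖²/R²` ((123) from a sup letter).
* §2 ★ `ineq148_of_sup` — same data on a finite product `ι → G`: for `‖A‖ < R/8`, `‖D(C − DC(0))(A)[δA]‖ ≤ (32B/R²)·‖A‖·Σ_b‖δA b‖` ((148) with `C″ = 32B/R²`, η-free).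
* §3 `ineq148_local` — for a map `Φ : (ι → G) → F` DEPENDING ONLY on the coordinates in a finite set `Rd` (read set), differentiable and bounded by `B` whenever the read
  coordinates are `< R`, `Φ 0 = 0`: at every `V` with `‖V i‖ ≤ s` on `Rd`, `s < R/8`, **`‖D(Φ − DΦ(0))(V)[w]‖ ≤ (32B/R²)·s·Σ_{i∈Rd}‖w i‖`** for every direction `w`
  (restriction∕zero-extension along `Rd`, chain rule) — literally the shape of `hE` (with ✓`ChartKernelTower.sum_norm_le_of_vanish` to pass from `Rd` to the reader set).
HONEST SCOPE.  Complex analysis + linear algebra; no lattice object.  NOT a claim about the stub, the crux, the rung or the mass gap.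

References: T. Bałaban, CMP **98** (1985) 17–51 [Balaban1985Averaging] ((123) p.36, (137)–(138) p.39, (148) p.40).
-/

noncomputable section

open scoped BigOperators
open Metric Set

namespace Summit.QuantumFields.YangMills.Theorems.ChartKernelCauchy

open Literature.MathematicalPhysics.QuantumFieldTheory.Balaban1983to89

/-! ## §1 (123) from a sup letter -/

section Sup

variable {E F : Type*} [NormedAddCommGroup E] [NormedSpace ℂ E] [NormedAddCommGroup F] [NormedSpace ℂ F] [CompleteSpace F]

/-- **THE QUADRATIC REMAINDER FROM A SUP LETTER**: `C` ℂ-differentiable on `ball 0 R` with `‖C‖ ≤ B` there and `C 0 = 0` ⇒ `‖C Z − DC(0) Z‖ ≤ 8B‖Z‖²/R²` whenever `4‖Z‖ ≤ R`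
(second-order Cauchy estimate on the complex line through `0` and `Z`). [cite: Balaban1985Averaging, (123) p.36] -/
theorem norm_sub_fderiv_zero_le_of_sup {C : E → F} {R B : ℝ} (hC : DifferentiableOn ℂ C (ball 0 R)) (hB : ∀ Z ∈ ball (0 : E) R, ‖C Z‖ ≤ B)
    (h0 : C 0 = 0) {Z : E} (hZ : 4 * ‖Z‖ ≤ R) (hR : 0 < R) :
    ‖C Z - fderiv ℂ C 0 Z‖ ≤ 8 * B * ‖Z‖ ^ 2 / R ^ 2 := by
  have hmem : (0 : E) ∈ ball (0 : E) R := mem_ball_self hR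
  have hv : 4 * ‖Z‖ ≤ R - ‖(0 : E) - 0‖ := by rw [sub_zero, norm_zero, sub_zero]; exact hZ
  have h := B7TransferAnalyticMean.norm_sub_sub_fderiv_le_of_line hC hB hmem hv
  rw [zero_add, h0, sub_zero, sub_zero, norm_zero, sub_zero] at h
  exact h

end Sup

/-! ## §2 (148) from a sup letter -/

section Kernel

variable {ι : Type*} [Fintype ι] {G : Type*} [NormedAddCommGroup G] [NormedSpace ℂ G] {F : Type*} [NormedAddCommGroup F] [NormedSpace ℂ F] [CompleteSpace F]

/-- ★ **(148) WITH `C″ = 32B/R²` FROM HOLOMORPHY + A SUP LETTER**: for `C : (ι → G) → F` ℂ-differentiable on the sup-ball `ball 0 R` with `‖C‖ ≤ B` there and `C 0 = 0`, the derivative of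
the second-order remainder `Z ↦ C Z − DC(0)Z` at any `A` with `‖A‖ < R/8` satisfies `‖D(C − DC(0))(A)[δA]‖ ≤ (32B/R²)·‖A‖·Σ_b‖δA b‖` — print's «|⟨δC(V₀,A)/δA, δA⟩| ≤ C″₁|A|Q″|δA|»
with the variables' weight `L^{−d}` left to the caller (the sum is the unweighted ℓ¹ mass). [cite: Balaban1985Averaging, (148) p.40] -/
theorem ineq148_of_sup {C : (ι → G) → F} {R B : ℝ} (hR : 0 < R) (hB0 : 0 ≤ B) (hC : DifferentiableOn ℂ C (ball 0 R))
    (hB : ∀ Z ∈ ball (0 : ι → G) R, ‖C Z‖ ≤ B) (h0 : C 0 = 0) {A : ι → G} (hA : ‖A‖ < R / 8) (δA : ι → G) :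
    ‖fderiv ℂ (fun Z => C Z - fderiv ℂ C 0 Z) A δA‖ ≤ 32 * B / R ^ 2 * ‖A‖ * ∑ b, ‖δA b‖ := by
  -- the remainder is differentiable on the small ball and quadratically bounded there
  set Cr : (ι → G) → F := fun Z => C Z - fderiv ℂ C 0 Z with hCr
  have hsub : ball (0 : ι → G) (R / 4) ⊆ ball 0 R := ball_subset_ball (by linarith)
  have hCr_diff : DifferentiableOn ℂ Cr (ball 0 (R / 4)) :=
    (hC.mono hsub).sub (fderiv ℂ C 0).differentiable.differentiableOn
  have hK0 : 0 ≤ 8 * B / R ^ 2 := by positivity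
  have hCr_sq : ∀ Z ∈ ball (0 : ι → G) (R / 4), ‖Cr Z‖ ≤ 8 * B / R ^ 2 * ‖Z‖ ^ 2 := by
    intro Z hZ
    rw [mem_ball_zero_iff] at hZ
    have h := norm_sub_fderiv_zero_le_of_sup hC hB h0 (Z := Z) (by linarith) hR
    calc ‖Cr Z‖ = ‖C Z - fderiv ℂ C 0 Z‖ := rfl
      _ ≤ 8 * B * ‖Z‖ ^ 2 / R ^ 2 := h
      _ = 8 * B / R ^ 2 * ‖Z‖ ^ 2 := by ring
  have hA' : ‖A‖ < R / 4 / 2 := by linarith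
  have h := B7Ineq148.norm_fderiv_apply_le_sum hK0 hCr_diff hCr_sq hA' δA
  calc ‖fderiv ℂ Cr A δA‖ ≤ 4 * (8 * B / R ^ 2) * ‖A‖ * ∑ b, ‖δA b‖ := h
    _ = 32 * B / R ^ 2 * ‖A‖ * ∑ b, ‖δA b‖ := by ring

end Kernel

/-! ## §3 Localisation to the read set -/

section Local

variable {ι : Type*} {G : Type*} [NormedAddCommGroup G] [NormedSpace ℂ G] {F : Type*} [NormedAddCommGroup F] [NormedSpace ℂ F] [CompleteSpace F]

/-- Zero-extension from a finite read set `Rd` to all coordinates, as a continuous linear map. [folklore] -/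
theorem exists_extendCLM (Rd : Finset ι) [DecidableEq ι] :
    ∃ X : (↥Rd → G) →L[ℂ] (ι → G), ∀ (w : ↥Rd → G) (i : ι), X w i = if h : i ∈ Rd then w ⟨i, h⟩ else 0 := by
  classical
  refine ⟨ContinuousLinearMap.pi fun i : ι => if h : i ∈ Rd then ContinuousLinearMap.proj (R := ℂ) (φ := fun _ : ↥Rd => G) ⟨i, h⟩ else 0, fun w i => ?_⟩
  by_cases h : i ∈ Rd
  · simp [h]
  · simp [h]

/-- Restriction to a finite read set `Rd`, as a continuous linear map. [folklore] -/
theorem exists_restrictCLM [Fintype ι] (Rd : Finset ι) :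
    ∃ P : (ι → G) →L[ℂ] (↥Rd → G), ∀ (W : ι → G) (x : ↥Rd), P W x = W x := by
  exact ⟨ContinuousLinearMap.pi fun x : ↥Rd => ContinuousLinearMap.proj (R := ℂ) (φ := fun _ : ι => G) (x : ι), fun W x => rfl⟩

/-- ★ **(148), LOCALISED TO THE READ SET**: let `Φ : (ι → G) → F` depend only on the coordinates in the finite set `Rd` (`Φ W = Φ W′` when `W = W′` on `Rd`), be ℂ-differentiable and
bounded by `B` at every `W` whose read coordinates have norm `< R`, and vanish at `0`.  Then at every `V` with `‖V i‖ ≤ s` on `Rd`, `0 ≤ s < R/8`, for every direction `w`: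
`‖D(Φ − DΦ(0))(V)[w]‖ ≤ (32B/R²)·s·Σ_{i∈Rd}‖w i‖` — the `hE` letter of ✓`ChartKernelTower.kernel_tower_bound` for a one-step chart read through its two blocks (`G = 32B/R²`; unread directions
contribute nothing). [cite: Balaban1985Averaging, (148) p.40, (140) p.39] -/
theorem ineq148_local [Fintype ι] [DecidableEq ι] (Rd : Finset ι) (Φ : (ι → G) → F)
    (hdep : ∀ W W' : ι → G, (∀ i ∈ Rd, W i = W' i) → Φ W = Φ W')
    {R B : ℝ} (hR : 0 < R) (hB0 : 0 ≤ B)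
    (hdiff : ∀ W : ι → G, (∀ i ∈ Rd, ‖W i‖ < R) → DifferentiableAt ℂ Φ W)
    (hB : ∀ W : ι → G, (∀ i ∈ Rd, ‖W i‖ < R) → ‖Φ W‖ ≤ B)
    (h0 : Φ 0 = 0)
    {V : ι → G} {s : ℝ} (hs0 : 0 ≤ s) (hs : s < R / 8) (hV : ∀ i ∈ Rd, ‖V i‖ ≤ s) (w : ι → G) :
    ‖fderiv ℂ (fun Z => Φ Z - fderiv ℂ Φ 0 Z) V w‖ ≤ 32 * B / R ^ 2 * s * ∑ i ∈ Rd, ‖w i‖ := by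
  obtain ⟨X, hX⟩ := exists_extendCLM (G := G) Rd
  obtain ⟨P, hP⟩ := exists_restrictCLM (G := G) Rd
  -- the function of the read variables
  set φ : (↥Rd → G) → F := fun a => Φ (X a) with hφ
  -- `Φ = φ ∘ P` by the dependence hypothesis
  have hXP : ∀ W : ι → G, ∀ i ∈ Rd, X (P W) i = W i := fun W i hi => by rw [hX, dif_pos hi, hP]
  have hfac : Φ = φ ∘ P := funext fun W => (hdep W (X (P W)) fun i hi => (hXP W i hi).symm)
  -- read coordinates of an extension
  have hXread : ∀ (a : ↥Rd → G) (i : ι) (hi : i ∈ Rd), X a i = a ⟨i, hi⟩ := fun a i hi => by rw [hX, dif_pos hi]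
  have hXnorm : ∀ (a : ↥Rd → G), ∀ i ∈ Rd, ‖X a i‖ ≤ ‖a‖ := fun a i hi => by rw [hXread a i hi]; exact norm_le_pi_norm a ⟨i, hi⟩
  -- `φ` is differentiable on the sup-ball and bounded there, `φ 0 = 0`
  have hφ_diff : DifferentiableOn ℂ φ (ball 0 R) := by
    intro a ha
    rw [mem_ball_zero_iff] at ha
    have hd : DifferentiableAt ℂ Φ (X a) := hdiff (X a) fun i hi => (hXnorm a i hi).trans_lt ha
    exact (hd.comp a X.differentiableAt).differentiableWithinAt
  have hφ_B : ∀ a ∈ ball (0 : ↥Rd → G) R, ‖φ a‖ ≤ B := by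
    intro a ha
    rw [mem_ball_zero_iff] at ha
    exact hB (X a) fun i hi => (hXnorm a i hi).trans_lt ha
  have hφ0 : φ 0 = 0 := by simp only [hφ, map_zero]; exact h0
  -- the point and the direction in read coordinates
  have hPV : ‖P V‖ ≤ s := by
    refine (pi_norm_le_iff_of_nonneg hs0).2 fun x => ?_
    rw [hP]; exact hV x x.2
  have hPV' : ‖P V‖ < R / 8 := lt_of_le_of_lt hPV hs
  have hmain := ineq148_of_sup hR hB0 hφ_diff hφ_B hφ0 hPV' (P w)
  -- identify the derivatives through `Φ = φ ∘ P`
  have hφ_at : ∀ a : ↥Rd → G, ‖a‖ < R → DifferentiableAt ℂ φ a := fun a ha =>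
    hφ_diff.differentiableAt (isOpen_ball.mem_nhds (mem_ball_zero_iff.mpr ha))
  have hR8 : R / 8 < R := by linarith
  have hdV : DifferentiableAt ℂ φ (P V) := hφ_at _ (hPV'.trans hR8)
  have hd0 : DifferentiableAt ℂ φ (P 0) := by rw [map_zero]; exact hφ_at _ (by rw [norm_zero]; exact hR)
  have hfd0 : fderiv ℂ Φ 0 = (fderiv ℂ φ 0).comp P := by
    rw [hfac, fderiv_comp 0 hd0 P.differentiableAt, P.fderiv, map_zero]
  have hrem : (fun Z => Φ Z - fderiv ℂ Φ 0 Z) = (fun a => φ a - fderiv ℂ φ 0 a) ∘ P := by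
    funext Z
    simp only [Function.comp_apply, hfd0, ContinuousLinearMap.comp_apply]
    rw [hfac, Function.comp_apply]
  have hdrem : DifferentiableAt ℂ (fun a => φ a - fderiv ℂ φ 0 a) (P V) := hdV.sub (fderiv ℂ φ 0).differentiableAt
  have hfdV : fderiv ℂ (fun Z => Φ Z - fderiv ℂ Φ 0 Z) V w = fderiv ℂ (fun a => φ a - fderiv ℂ φ 0 a) (P V) (P w) := by
    rw [hrem, fderiv_comp V hdrem P.differentiableAt, P.fderiv, ContinuousLinearMap.comp_apply]
  rw [hfdV]
  -- the ℓ¹ mass of the restricted direction is the mass over `Rd`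
  have hsum : ∑ x : ↥Rd, ‖P w x‖ = ∑ i ∈ Rd, ‖w i‖ := by
    simp only [hP]
    exact Finset.sum_coe_sort Rd (fun i => ‖w i‖)
  calc ‖fderiv ℂ (fun a => φ a - fderiv ℂ φ 0 a) (P V) (P w)‖ ≤ 32 * B / R ^ 2 * ‖P V‖ * ∑ x : ↥Rd, ‖P w x‖ := hmain
    _ ≤ 32 * B / R ^ 2 * s * ∑ x : ↥Rd, ‖P w x‖ := by
        have hS : 0 ≤ ∑ x : ↥Rd, ‖P w x‖ := Finset.sum_nonneg fun _ _ => norm_nonneg _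
        have hc : 0 ≤ 32 * B / R ^ 2 := by positivity
        exact mul_le_mul_of_nonneg_right (mul_le_mul_of_nonneg_left hPV hc) hS
    _ = 32 * B / R ^ 2 * s * ∑ i ∈ Rd, ‖w i‖ := by rw [hsum]

end Local

end Summit.QuantumFields.YangMills.Theorems.ChartKernelCauchy

end
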